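import Summits.QuantumFields.QCD.Theses.NestedDissectionSea
import Summits.QuantumFields.QCD.Theorems.NegativeCellsDilute.Negative.PinWindow
import Summits.QuantumFields.QCD.Theorems.NegativeCellsDilute.Negative.CellPositivity
import Summits.QuantumFields.QCD.Theorems.CoerciveSea.Negative.SeilerBothSides
import Literature.MathematicalPhysics.QuantumFieldTheory.QCDPhaseQuenchedReweighting
import Literature.MathematicalPhysics.QuantumLattice.WilsonPositivityDomain
import HarnessLib.Audit

/-!
# Line `sign-mobility-identity` for crux `NestedDissectionSea.NegativeCellsDilute`
# (stmt-QuantumFields-13900, rank 2, route-QuantumFields-NestedDissectionSea)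

Skeleton (crux-plan, planner-cruxplan-stmt-QuantumFields-13900-sign-mobility-identi-0, 2026-08-16) of the
crux idea `Ideas/sign-mobility-identity.md` (ideator 2, round 1; triage r1-2 PASS, r1-3 PASS — both with the
same sharpening, acted on below: the typed `∃κ` transfer `PinOfMobility` is a costume of the pin, the content
is the block FLOOR and the ratio MIXING with the kernel FIXED to be the block heat-bath (Gibbs) resampling).

The crux (route file, verbatim; `negativeCellsDilute_iff` below is `Iff.rfl`):
`∀ N_f ∈ {2,3} ∃ reg (HasMassScaling, HasAsymptoticScaling) ∃ M₀ b₀ ℓ ∀ m > M₀ ∃ R > 0, (a) ∧ (b)` with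
(a) = `DilutionClause reg b₀ ℓ m R` (windowed local dilution of sign defects) and
(b) = `PinClause reg m M₀ R` (parity pin: a physical distance `M > M₀` below `m_crit(k)` the torus
determinant is negative with phase-quenched probability `≥ 1/4` on EVERY odd torus of physical side `≥ R`).
The standing disprover's `withoutPin_holds` (landed `Theorems/NegativeCellsDilute/Negative/CellPositivity.lean`)
shows (b) is the sole carrier of content; this line is a line ON (b).

## The line in one paragraph

SIGN–MOBILITY IDENTITY: for the phase-quenched measure `pq` (tree `qcdLatticeMeasure N β mq`, a positive
weight, so stationary dynamics exist for free) and the `±1` observable `σ = detSign μp` (sign of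
`Re det D_W(U, μp, 1)` at the probe mass), resampling the links of ANY link set `B` from their conditional
law given the rest leaves `pq` invariant, and `(κ_B σ)(U) = σ(U)(1 − 2 m_B(U))` where
`m_B(U) = flipRate β mq μp B U ∈ [0,1]` is the conditional probability that the resampling flips the sign;
hence `E_pq[σ · m_B] = 0` for every `B` (`stub_signMobility`; equivalently: the double integral over old and
new interiors is antisymmetric under swapping them). Averaging over a GRID of `K = k₁⁴` disjoint blocks of
physical side `L_b` at mutual distance `≥ d₀` gives `E[σ · m̄] = 0`, `m̄ = K⁻¹ Σ_b m_b ∈ [0,1]`, whence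
`c·|E σ| ≤ E|m̄ − c| ≤ Var(m̄)^{1/2}` with `c = E m̄`, and `Var(m̄) ≤ c/K + θ c²` from `m_b ≤ 1` and the
pairwise relative covariance bound `θ`; so `E m_b ≥ p₀`, `1/(K p₀) + θ ≤ 1/4` give `|E σ| ≤ 1/2`, i.e.
`P(σ = −1) ≥ 1/4` (`stub_concentration`, pure measure theory). `stub_pinOfFloor` runs this on the torus:
given the BLOCK FLOOR (`BlockFloor`: `E_pq m_b ≥ p₀` for every block of side `⌈L_b/a_k⌉`, k-, volume- and
position-uniformly, at every probe depth `M > M₀`) and RATIO MIXING (`RatioMixing`: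
`Cov_pq(m_b, m_b′) ≤ θ E m_b E m_b′` for blocks `⌈d₀/a_k⌉`-apart, `θ ≤ 1/8`) it places `k₁⁴ ≥ 8/p₀` blocks in
every odd torus of physical side `≥ R₀ = k₁(L_b + d₀) + 1` and delivers `PinClause` for all `R ≥ R₀` — the
absolute size of the tunnelling propensity `p₀` CANCELS, only its k-uniformity and the number of blocks
matter (`R` is chosen after `m`, before `M` and `k`: legal). `stub_tunedWitness` is the physics: ONE
regularisation carrying clause (a) (the partner (a)-line's deliverable — EarlyCrosserLaw (a′), or the
transfers of cards `mass-wegner-cell-index` / `count-the-flow` — which pins `m_crit` from BELOW) together with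
the floor (conditional sign non-degeneracy of one semiclassical block: `E m_b = 2E[r_b(1 − r_b)]`,
`r_b = P_pq(σ = +1 | links off b)`; a k-uniform LOWER bound from asymptotic scaling of the small-lump density,
which pins `m_crit` from ABOVE) and the mixing (clustering of the pq measure at physical separation). The two
halves cannot be separate stubs: they are coupled through the shared witness `reg` ((a) alone holds for the
heavy junk `mcrit ≡ 1`, the floor alone for `mcrit ≡ −1`; neither implies the other).

## Composition

`NegativeCellsDilute_of : S₁ → S₂ → S₃ → S₄ → NegativeCellsDilute` (sorry-free): read the crux through
`negativeCellsDilute_iff`; take `reg, M₀, b₀, ℓ` and, per `m`, `R, L_b, d₀, p₀, θ` from S₄; S₃ (fed S₁, S₂)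
turns floor + mixing into `PinClause` for all `R′ ≥ R₀`; answer with `R′ = max R R₀`
(`dilutionClause_mono`). `NegativeCellsDilute_skeleton` instantiates it with the four `stub_*`.

## Disproof.lean / negatives honoured

`Cruxes/NegativeCellsDilute/Disproof.lean` v4 (cdisprove; NO KILL; no `_false_without_` theorem exists, so none
can be cited): §2 `withoutPin_holds` / landed `NegativeCellsDiluteCellPositivity.negativeCellsDilute_without_pin`
— the pin is the sole content; this line's open stub S₄ carries the pin's replacement (floor + mixing) and
NOT the pin; §1 `pin_window` / landed `NegativeCellsDilutePinWindow.pin_window` and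
`CoerciveSeaNegative.fermionDet_wilsonDirac_re_pos_of_pos_or_lt` — HONOURED AND RE-DERIVED:
`blockFloor_window` below (sorry-free) shows the floor forces the same probe window `[−8, 0]` eventually in
`k` (outside it `detSign ≡ +1` for every field, `flipRate ≡ 0`, `E m_b = 0 < p₀`), so S₄ is consistent with
the landed negative lemmas and kills the same junk witnesses (`mcrit ≡ c > 0`, `→ +∞`, `≡ c < −8`). Triage
r1-3 PROBE 2 `iid_kernel_concentration` (the `∃κ` form is two-sided equivalent to the pin): answered — no
kernel is quantified anywhere; `flipRate` is the heat-bath propensity of a NAMED link set. Negatives index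
(`ledger negatives --problem QuantumFields`, 2026-08-16: 9494, 9599, 9603, 9665 — adaptive coarse system,
multiboson admissibility/gap, diagonal-mirror RP): untouched (no RP, no multiboson data, no coarse system).
-/

noncomputable section

open scoped BigOperators ENNReal Classical
open MeasureTheory Filter
open Literature.MathematicalPhysics.QuantumLattice Literature.MathematicalPhysics.QuantumFieldTheory
  Literature.Probability.LatticeModels

namespace Summit.QuantumFields.QCD.Cruxes.NegativeCellsDilute.SignMobilityIdentity

/-! ### §0a Vocabulary: the sign, link blocks, heat-bath resampling, the flip propensity -/

/-- `SU(3)` lattice gauge fields on the four-torus of side `N` (the crux's `GaugeConfig 4 N (SU(3))`). -/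
abbrev Cfg (N : ℕ) : Type := GaugeConfig 4 N SU3

section Block

variable {N : ℕ}

/-- The `±1` observable of the line: `σ(U) = −1` if `Re det D_W(U, μp, 1) < 0` (the crux's pin event at the
probe mass `μp`), `+1` otherwise. By `fermionDet_wilsonDirac_eq_sign_mul` (tree) this is `(−1)^{n₋}`, the parity
of the number of real Wilson modes below `−μp`; no geometric topological charge is ever defined. -/
def detSign [NeZero N] (μp : ℝ) (U : Cfg N) : ℝ :=
  if (fermionDet (wilsonDirac (fundamentalRep (Fin 3)) U μp 1)).re < 0 then -1 else 1

/-- The LINK BLOCK of base `x` and side `n`: the positively oriented edges whose base point lies in the closed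
box `x + [0, n)⁴` of the torus (offsets read through `ZMod.val`). -/
def linkBlock (x : TorusSite 4 N) (n : ℕ) : Set (Edge 4 N) :=
  {e | ∀ i, (e.1 i - x i).val < n}

/-- Override the links of `B` in `U` by those of `V` (heat-bath proposal: new interior `V|_B`, old exterior). -/
def refit (B : Set (Edge 4 N)) (U V : Cfg N) : Cfg N :=
  fun e => if e ∈ B then V e else U e

/-- Product Haar probability on all links of the torus (the reference measure of `wilsonMeasure`). -/
def haarPi (N : ℕ) [NeZero N] : Measure (Cfg N) :=
  Measure.pi fun _ : Edge 4 N => haarProbability SU3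

/-- The full phase-quenched weight `e^{−β S_W(U)} ∏_f |det D_W(U, m_f, 1)|` (density of the pq measure
`qcdLatticeMeasure N β mq` w.r.t. product Haar, up to normalisation; the fermionic factor is VERBATIM the
crux's `wt`). -/
def pqWeight [NeZero N] (β : ℝ) {Nf : ℕ} (mq : Fin Nf → ℝ) (U : Cfg N) : ℝ :=
  Real.exp (-(β * wilsonAction (fundamentalRep (Fin 3)) U)) *
    ∏ f, ‖fermionDet (wilsonDirac (fundamentalRep (Fin 3)) U (mq f) 1)‖

/-- **The block flip propensity `m_B(U)`**: the conditional probability, under the pq measure given all links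
OFF `B` equal to those of `U`, that resampling the links of `B` flips the sign `detSign μp` — written as the
ratio of interior integrals of the full weight with the exterior frozen (`x/0 = 0`: the value is `0` on the
null set of exteriors of zero conditional mass; always in `[0,1]`). This is `κ_B(U, {σ ≠ σ(U)})` for the
heat-bath kernel `κ_B` of block `B`, which leaves `qcdLatticeMeasure` invariant; EXACTLY
`E_pq m_B = 2 E_pq[r_B (1 − r_B)]`, `r_B = P_pq(σ = +1 | links off B)` (old and new interiors are
conditionally i.i.d.). -/
def flipRate [NeZero N] (β : ℝ) {Nf : ℕ} (mq : Fin Nf → ℝ) (μp : ℝ) (B : Set (Edge 4 N)) (U : Cfg N) : ℝ :=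
  (∫ V, (if detSign μp (refit B U V) ≠ detSign μp U then (1 : ℝ) else 0) * pqWeight β mq (refit B U V)
      ∂(haarPi N)) /
    ∫ V, pqWeight β mq (refit B U V) ∂(haarPi N)

/-- Two boxes of side `n` based at `x`, `x′` are `g`-APART on the torus: in some coordinate direction every
pair of their lattice coordinates is at cyclic distance `≥ g` (sup-metric separation `≥ g` of the site boxes,
hence of the link blocks). -/
def BoxesApart [NeZero N] (x x' : TorusSite 4 N) (n g : ℕ) : Prop :=
  ∃ i : Fin 4, ∀ t t' : ℕ, t < n → t' < n →
    g ≤ ((x i + t) - (x' i + t')).val ∧ g ≤ ((x' i + t') - (x i + t)).val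

end Block

/-! ### §0b Packaging of the crux's clause texts (verbatim) -/

section Packaging

variable {Nf : ℕ}

/-- The crux's bare valence-mass trajectory `m_f(k) = m_crit(k) + a_k m_f / Z_m(k)` (its `let mq`). -/
abbrev bare (reg : QCDRegularisation Nf) (m : Fin Nf → ℝ) (k : ℕ) : Fin Nf → ℝ :=
  fun f => reg.mcrit k + reg.a k * m f / reg.Zm k

/-- The crux's probe mass `m_crit(k) − a_k M / Z_m(k)`, a physical distance `M` below the line. -/
abbrev probe (reg : QCDRegularisation Nf) (M : ℝ) (k : ℕ) : ℝ :=
  reg.mcrit k - reg.a k * M / reg.Zm k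

/-- Clause (a) of `NegativeCellsDilute` — WINDOWED LOCAL DILUTION — for `(reg, b₀, ℓ, m, R)`, VERBATIM the first
conjunct of the crux body (it does not mention `M₀`). In this line it is the partner (a)-line's deliverable. -/
def DilutionClause (reg : QCDRegularisation Nf) (b₀ : ℕ) (ℓ : ℝ) (m : Fin Nf → ℝ) (R : ℝ) : Prop :=
  ∀ ε : ℝ, 0 < ε → ∀ᶠ k : ℕ in Filter.atTop, ∀ S : ℕ, R ≤ reg.a k * (2 * S + 1) → let N : ℕ := 2 * S + 1; let mq : Fin Nf → ℝ := fun f => reg.mcrit k + reg.a k * m f / reg.Zm k; let wt : GaugeConfig 4 N (Matrix.specialUnitaryGroup (Fin 3) ℂ) → ℝ := fun U => ∏ f, ‖fermionDet (wilsonDirac (fundamentalRep (Fin 3)) U (mq f) 1)‖; let P : (GaugeConfig 4 N (Matrix.specialUnitaryGroup (Fin 3) ℂ) → Prop) → ℝ := fun E => (∫ U, (if E U then (1 : ℝ) else 0) * wt U ∂(wilsonMeasure (d := 4) (L := N) (fundamentalRep (Fin 3)) (reg.β k))) / (∫ U, wt U ∂(wilsonMeasure (d := 4) (L := N) (fundamentalRep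 (Fin 3)) (reg.β k))); let J : ℕ := Nat.log 2 (⌊ℓ / reg.a k⌋₊ / b₀) + 1; ∃ δ : ℕ → ℝ, ∑ j ∈ Finset.range J, δ j ≤ ε ∧ ∀ j < J, ∀ s : Fin 4 → ℕ, (∀ i, b₀ * 2 ^ j ≤ s i ∧ s i < b₀ * 2 ^ (j + 2) ∧ s i ≤ N ∧ (s i : ℝ) * reg.a k ≤ ℓ) → P (fun U => ∃ f, IsSignDefect U (mq f) j s) ≤ δ j

/-- Clause (b) of `NegativeCellsDilute` — the PARITY PIN — for `(reg, m, M₀, R)`, VERBATIM the second conjunct of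
the crux body (identical to the disprover's `Disproof.PinClause`): for every `M > M₀`, eventually in `k`, on
every odd torus of physical side `≥ R`, `1/4 ≤ P_pq(Re det D_W(U, m_crit(k) − a_k M/Z_m(k), 1) < 0)`. -/
def PinClause (reg : QCDRegularisation Nf) (m : Fin Nf → ℝ) (M₀ R : ℝ) : Prop :=
  ∀ M : ℝ, M₀ < M → ∀ᶠ k : ℕ in Filter.atTop, ∀ S : ℕ, R ≤ reg.a k * (2 * S + 1) → let N : ℕ := 2 * S + 1; let mq : Fin Nf → ℝ := fun f => reg.mcrit k + reg.a k * m f / reg.Zm k; let wt : GaugeConfig 4 N (Matrix.specialUnitaryGroup (Fin 3) ℂ) → ℝ := fun U => ∏ f, ‖fermionDet (wilsonDirac (fundamentalRep (Fin 3)) U (mq f) 1)‖; (1 / 4 : ℝ) ≤ (∫ U, (if (fermionDet (wilsonDirac (fundamentalRep (Fin 3)) U (reg.mcrit k - reg.a k * M / reg.Zm k) 1)).re < 0 then (1 : ℝ) else 0) * wt U ∂(wilsonMeasure (d := 4) (L := N) (fundamentalRep (Fin 3)) (reg.β k))) / (∫ U, wt U ∂(wilsonMeasure (d := 4) (L :=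 N) (fundamentalRep (Fin 3)) (reg.β k)))

/-- **The crux re-read through the packaging** (definitional; certifies that `DilutionClause` and `PinClause`
are the two conjuncts of the crux body verbatim). -/
theorem negativeCellsDilute_iff :
    Summit.QuantumFields.QCD.Theses.NestedDissectionSea.NegativeCellsDilute ↔
      ∀ Nf : ℕ, (Nf = 2 ∨ Nf = 3) → ∃ reg : QCDRegularisation Nf, reg.HasMassScaling ∧
        (reg.scheme 0 0 0).HasAsymptoticScaling ∧ ∃ M₀ : ℝ, 0 ≤ M₀ ∧ ∃ b₀ : ℕ, 2 ≤ b₀ ∧ ∃ ℓ : ℝ, 0 < ℓ ∧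
        ∀ m : Fin Nf → ℝ, (∀ f, M₀ < m f) → ∃ R : ℝ, 0 < R ∧
          DilutionClause reg b₀ ℓ m R ∧ PinClause reg m M₀ R :=
  Iff.rfl

/-! ### §0c The typed transfer `C⁺_b` (triage sharpening): block floor and ratio mixing, NO `∃κ` -/

/-- **BLOCK FLOOR** for `(reg, M₀, m)` with block side `L_b`, floor `p₀`, torus threshold `R_f`: for every probe
depth `M > M₀`, eventually in `k`, on EVERY odd torus of physical side `≥ R_f` and for EVERY base point `x`, the
phase-quenched expectation (tree `qcdPhaseQuenchedExpect` = the crux's quotient, `qcdPhaseQuenchedExpect_eq_div_prod`)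
of the flip propensity of the link block of side `⌈L_b/a_k⌉` at `x` — at valence masses `m_f(k)`, sign read
at the probe `m_crit(k) − a_k M/Z_m(k)` — is at least `p₀`. Informally: re-drawing one block of physical side
`L_b` from its conditional law flips the torus sign with probability `≥ p₀`, uniformly in `k`, the volume and
the position (`E m_b = 2E[r_b(1 − r_b)]`: conditional sign non-degeneracy of one semiclassical block). -/
def BlockFloor (reg : QCDRegularisation Nf) (M₀ : ℝ) (m : Fin Nf → ℝ) (Lb p₀ Rf : ℝ) : Prop :=
  ∀ M : ℝ, M₀ < M → ∀ᶠ k : ℕ in atTop, ∀ S : ℕ, Rf ≤ reg.a k * (2 * S + 1) →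
    ∀ x : TorusSite 4 (2 * S + 1),
      p₀ ≤ qcdPhaseQuenchedExpect (reg.β k) (2 * S + 1) (bare reg m k)
        (flipRate (reg.β k) (bare reg m k) (probe reg M k) (linkBlock x ⌈Lb / reg.a k⌉₊))

/-- **RATIO MIXING** for `(reg, M₀, m)` with block side `L_b`, gap `d₀`, constant `θ`, torus threshold `R_f`: for
every `M > M₀`, eventually in `k`, on every odd torus of physical side `≥ R_f`, for every two base points whose
blocks of side `⌈L_b/a_k⌉` are `⌈d₀/a_k⌉`-apart on the torus, the phase-quenched covariance of the two flip
propensities is at most `θ` times the product of their means (one-sided, relative: the form the second-moment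
step consumes; the absolute scale of the propensities cancels). -/
def RatioMixing (reg : QCDRegularisation Nf) (M₀ : ℝ) (m : Fin Nf → ℝ) (Lb d₀ θ Rf : ℝ) : Prop :=
  ∀ M : ℝ, M₀ < M → ∀ᶠ k : ℕ in atTop, ∀ S : ℕ, Rf ≤ reg.a k * (2 * S + 1) →
    ∀ x x' : TorusSite 4 (2 * S + 1), BoxesApart x x' ⌈Lb / reg.a k⌉₊ ⌈d₀ / reg.a k⌉₊ →
      qcdPhaseQuenchedExpect (reg.β k) (2 * S + 1) (bare reg m k)
          (fun U => flipRate (reg.β k) (bare reg m k) (probe reg M k) (linkBlock x ⌈Lb / reg.a k⌉₊) U *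
            flipRate (reg.β k) (bare reg m k) (probe reg M k) (linkBlock x' ⌈Lb / reg.a k⌉₊) U) -
        qcdPhaseQuenchedExpect (reg.β k) (2 * S + 1) (bare reg m k)
            (flipRate (reg.β k) (bare reg m k) (probe reg M k) (linkBlock x ⌈Lb / reg.a k⌉₊)) *
          qcdPhaseQuenchedExpect (reg.β k) (2 * S + 1) (bare reg m k)
            (flipRate (reg.β k) (bare reg m k) (probe reg M k) (linkBlock x' ⌈Lb / reg.a k⌉₊)) ≤
      θ * (qcdPhaseQuenchedExpect (reg.β k) (2 * S + 1) (bare reg m k)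
            (flipRate (reg.β k) (bare reg m k) (probe reg M k) (linkBlock x ⌈Lb / reg.a k⌉₊)) *
          qcdPhaseQuenchedExpect (reg.β k) (2 * S + 1) (bare reg m k)
            (flipRate (reg.β k) (bare reg m k) (probe reg M k) (linkBlock x' ⌈Lb / reg.a k⌉₊)))

end Packaging

/-! ### §0d The four stub STATEMENTS (`Statement.stub_*`; the registered `stub_*` theorems of §1 assert them BY NAME)

The statements live in the sub-namespace `Statement` under the SAME short names as the sorried theorems, so that
the composition `NegativeCellsDilute_of : Statement.stub_signMobility → … → NegativeCellsDilute` takes exactly the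
registered stubs as hypotheses, by name (skeleton audit A12). Nicknames used in prose: S₁ = SignMobility,
S₂ = Concentration, S₃ = PinOfFloorMixing, S₄ = TunedWitness. -/

namespace Statement

/-- **SIGN–MOBILITY IDENTITY for block heat-bath resampling** (S₁, nickname SignMobility; asserted by
`stub_signMobility`): on every torus, for every coupling, mass tuple, probe mass and EVERY link set `B`, the flip propensity `flipRate β mq μp B` is a
measurable `[0,1]`-valued function ORTHOGONAL TO THE SIGN under the phase-quenched probability measure:
`∫ detSign · flipRate d(qcdLatticeMeasure) = 0`. -/
def stub_signMobility : Prop :=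
  ∀ (N : ℕ) [NeZero N] (Nf : ℕ) (β : ℝ) (mq : Fin Nf → ℝ) (μp : ℝ) (B : Set (Edge 4 N)),
    Measurable (flipRate β mq μp B) ∧
    (∀ U : Cfg N, 0 ≤ flipRate β mq μp B U ∧ flipRate β mq μp B U ≤ 1) ∧
    ∫ U, detSign μp U * flipRate β mq μp B U ∂(qcdLatticeMeasure N β mq) = 0

/-- **CONCENTRATION ⇒ QUARTER PIN** (S₂, nickname Concentration; asserted by `stub_concentration`; abstract
probability): on a probability space, a `±1` observable `σ` orthogonal to each of `K ≥ 1` propensities `m_b ∈ [0,1]` whose means are `≥ p₀ > 0`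
and whose pairwise covariances are `≤ θ ·` (product of means), with `1/(K p₀) + θ ≤ 1/4`, takes the value `−1`
with probability `≥ 1/4`. (`c|Eσ| ≤ E|m̄ − c| ≤ Var(m̄)^{1/2}`, `Var(m̄) ≤ c/K + θc²`, `c = E m̄ ≥ p₀`.) -/
def stub_concentration : Prop :=
  ∀ (Ω : Type) [MeasurableSpace Ω] (P : Measure Ω) [IsProbabilityMeasure P] (K : ℕ)
    (σ : Ω → ℝ) (mb : Fin K → Ω → ℝ) (p₀ θ : ℝ),
    0 < K → Measurable σ → (∀ ω, σ ω = 1 ∨ σ ω = -1) →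
    (∀ b, Measurable (mb b)) → (∀ b ω, 0 ≤ mb b ω ∧ mb b ω ≤ 1) →
    (∀ b, ∫ ω, σ ω * mb b ω ∂P = 0) →
    0 < p₀ → (∀ b, p₀ ≤ ∫ ω, mb b ω ∂P) → 0 ≤ θ →
    (∀ b b', b ≠ b' →
      ∫ ω, mb b ω * mb b' ω ∂P - (∫ ω, mb b ω ∂P) * (∫ ω, mb b' ω ∂P) ≤
        θ * ((∫ ω, mb b ω ∂P) * ∫ ω, mb b' ω ∂P)) →
    1 / ((K : ℝ) * p₀) + θ ≤ 1 / 4 →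
    (1 / 4 : ℝ) ≤ (P {ω | σ ω = -1}).toReal

/-- **PIN FROM FLOOR AND MIXING** (S₃, nickname PinOfFloorMixing; asserted by `stub_pinOfFloor`): given the two
packages above (taken as hypotheses, by name), for every `reg, M₀, m`, block data `L_b, d₀ > 0`, floor `p₀ > 0` and mixing constant `0 ≤ θ ≤ 1/8`, `BlockFloor ∧ RatioMixing` imply the crux's
`PinClause` on all odd tori of physical side `≥ R₀`, for some `R₀ > 0`. -/
def stub_pinOfFloor : Prop :=
  stub_signMobility → stub_concentration →
    ∀ (Nf : ℕ) (reg : QCDRegularisation Nf) (M₀ : ℝ) (m : Fin Nf → ℝ) (Lb d₀ p₀ θ Rf : ℝ),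
      0 < Lb → 0 < d₀ → 0 < p₀ → 0 ≤ θ → θ ≤ 1 / 8 →
      BlockFloor reg M₀ m Lb p₀ Rf → RatioMixing reg M₀ m Lb d₀ θ Rf →
      ∃ R₀ : ℝ, 0 < R₀ ∧ ∀ R : ℝ, R₀ ≤ R → PinClause reg m M₀ R

/-- **THE TUNED WITNESS** (S₄, nickname TunedWitness; asserted by `stub_tunedWitness`; the open physics): for
`N_f ∈ {2,3}` ONE mass-independent regularisation (HasMassScaling, HasAsymptoticScaling) with `M₀, b₀, ℓ` such that every mass tuple `m > M₀` has a size `R`,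
block data `L_b, d₀`, a floor `p₀ > 0` and a mixing constant `θ ≤ 1/8` with clause (a) (`DilutionClause`, the partner
(a)-line's deliverable), the block floor and the ratio mixing — all for the SAME `reg`. -/
def stub_tunedWitness : Prop :=
  ∀ Nf : ℕ, (Nf = 2 ∨ Nf = 3) → ∃ reg : QCDRegularisation Nf, reg.HasMassScaling ∧
    (reg.scheme 0 0 0).HasAsymptoticScaling ∧ ∃ M₀ : ℝ, 0 ≤ M₀ ∧ ∃ b₀ : ℕ, 2 ≤ b₀ ∧ ∃ ℓ : ℝ, 0 < ℓ ∧
    ∀ m : Fin Nf → ℝ, (∀ f, M₀ < m f) → ∃ R : ℝ, 0 < R ∧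
      ∃ Lb d₀ p₀ θ : ℝ, 0 < Lb ∧ 0 < d₀ ∧ 0 < p₀ ∧ 0 ≤ θ ∧ θ ≤ 1 / 8 ∧
        DilutionClause reg b₀ ℓ m R ∧ BlockFloor reg M₀ m Lb p₀ R ∧ RatioMixing reg M₀ m Lb d₀ θ R

end Statement

/-! ### §1 Registered stubs -/

/-- **Stub 1 — the sign–mobility identity for block heat-bath resampling (provable now; size M–L).**
For every link set `B`: `flipRate` is measurable (joint measurability of `(U, V) ↦ pqWeight (refit B U V)`,
continuity of `U ↦ det D_W(U, ·, 1)`, `Measurable.integral_prod_right`), `[0,1]`-valued (numerator integrand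
`≤` denominator integrand, both `≥ 0`; `x/0 = 0`), and `∫ σ m_B d(pq) = 0`. Proof of the identity: write
`pq = Z⁻¹ · pqWeight · haarPi` (`qcdLatticeMeasure`/`qcdLatticeWeight`/`wilsonWeight` unfolded), split
`haarPi = Haar^B ⊗ Haar^{Bᶜ}` (`MeasureTheory.measurePreserving_piEquivPiSubtypeProd`); the conditional mass
`Z_B(U) = ∫ pqWeight (refit B U V) dV` depends on the exterior only, and
`∫ σ(U) m_B(U) pqWeight(U) dU = ∫ dU_ext Z_B⁻¹ ∬ σ(U_B) 1{σ(V_B) ≠ σ(U_B)} w(V_B) w(U_B) dU_B dV_B` whose inner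
integrand is ANTISYMMETRIC under `U_B ↔ V_B` (on the event, `σ(V_B) = −σ(U_B)`), hence zero (Fubini; all
integrands bounded: `pqWeight` is continuous on a compact space). Equivalently: heat-bath resampling leaves `pq`
invariant and `(κ_B σ) = σ(1 − 2 m_B)` (Levin–Peres, Glauber/heat-bath stationarity). Why it might fail: it
cannot as mathematics; a failure would expose a convention slip in `refit`/`flipRate` (repair the definition,
not the line). Leans on: tree `qcdLatticeMeasure`, `qcdLatticeWeight_univ`, `continuous_wilsonDirac`,
`measurable_norm_det_diracMatrix`, `isProbabilityMeasure_qcdLatticeMeasure`; Mathlib `Measure.pi`,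
`measurePreserving_piEquivPiSubtypeProd`, `integral_prod`, `integral_neg_eq_self`-type symmetry. -/
theorem stub_signMobility : Statement.stub_signMobility := by
  sorry

/-- **Stub 2 — concentration of an additive flip rate gives the quarter pin (provable now; size M).**
Pure measure theory / inequalities, see `Statement.stub_concentration`: with `m̄ = K⁻¹ Σ_b m_b` and `c = ∫ m̄ ≥ p₀`,
orthogonality gives `c ∫σ = ∫ σ (c − m̄)`, so `c |∫σ| ≤ ∫|m̄ − c| ≤ (∫(m̄ − c)²)^{1/2}` (Cauchy–Schwarz /
Jensen on a probability space); `∫(m̄ − c)² = K⁻² Σ_{b,b′} Cov(m_b, m_b′) ≤ K⁻² Σ_b ∫m_b + θ K⁻² Σ_{b≠b′} ∫m_b ∫m_b′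
≤ c/K + θ c²` (`Var m_b ≤ ∫ m_b` since `0 ≤ m_b ≤ 1`; `Σ_{b≠b′} μ_b μ_b′ ≤ (Σ μ_b)²`); hence
`(∫σ)² ≤ 1/(Kc) + θ ≤ 1/(K p₀) + θ ≤ 1/4`, `∫σ ≤ 1/2`, and `P(σ = −1) = (1 − ∫σ)/2 ≥ 1/4`
(`∫σ = 1 − 2 P(σ = −1)` for a `±1`-valued measurable `σ` under a probability measure). Why it might fail: it
cannot (checked by hand in the line card; `K = 0` is excluded explicitly because `1/0 = 0` in Lean). Leans on:
Mathlib `integral_mul_le_Lp_mul_Lq`/`inner_mul_le_norm_mul_norm` (or `ConvexOn.map_integral_le`),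
`integral_add/sub/const`, `measureReal`/`probReal` API. -/
theorem stub_concentration : Statement.stub_concentration := by
  sorry

/-- **Stub 3 — the pin from floor and mixing (provable now GIVEN stubs 1–2, which it takes as hypotheses; size
M–L: torus block geometry + identification of the crux's quotient).** For every `reg, M₀, m` and block data
`L_b, d₀ > 0`, floor `p₀ > 0`, mixing constant `0 ≤ θ ≤ 1/8`: `BlockFloor ∧ RatioMixing ⇒ PinClause` on all
tori of physical side `≥ R₀`. Proof plan: choose `k₁ ∈ ℕ` with `k₁⁴ p₀ ≥ 8` and put
`R₀ = max R_f (k₁ (L_b + d₀) + 1)`; given `M > M₀`, intersect the two `∀ᶠ k` hypotheses with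
`∀ᶠ k, a_k k₁ ≤ 1` (`reg.tendsto_a`); for such `k` and any `S` with `R ≤ a_k(2S+1)`, `R ≥ R₀`, the grid
`x_I = I · (n + g)`, `I ∈ {0,…,k₁−1}⁴`, `n = ⌈L_b/a_k⌉`, `g = ⌈d₀/a_k⌉` fits (`k₁(n+g) ≤ 2S+1`) and distinct grid
blocks are `BoxesApart … n g` (they differ in a coordinate `i`, where the cyclic distance is `≥ g` both ways
BECAUSE `k₁(n+g) ≤ N`); apply S₂ (`Statement.stub_concentration`) on `(Cfg N, qcdLatticeMeasure N β_k (bare reg m k))` — a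
probability measure since the floor makes `⟨flipRate⟩₊ ≥ p₀ > 0`, so the denominator `∫∏|det| dμ_W` is non-zero
(`qcdPhaseQuenchedExpect` is junk `0` otherwise), then `isProbabilityMeasure_qcdLatticeMeasure` — with
`σ = detSign (probe reg M k)`, `mb I = flipRate … (linkBlock x_I n)`, orthogonality/measurability/range from
S₁ (`Statement.stub_signMobility`), means `≥ p₀` from the floor and covariances from the mixing (both rewritten as integrals by
`qcdPhaseQuenchedExpect_eq_integral_qcdLatticeMeasure`), `1/(k₁⁴ p₀) + θ ≤ 1/8 + 1/8`; finally
`P {σ = −1}` is the crux's quotient: `{σ = −1} = {Re det < 0}`, `(qcdLatticeMeasure …).real {…} = ∫ 1_{…}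
d(qcdLatticeMeasure) = qcdPhaseQuenchedExpect … (indicator) = (∫ 1_{…} ∏|det| dμ_W)/(∫ ∏|det| dμ_W)`
(`qcdPhaseQuenchedExpect_eq_div_prod`, literally the `PinClause` text). Why it might fail: only through a
mismatch between `BoxesApart`/`linkBlock` and the grid arithmetic in `ZMod (2S+1)` (then repair the separation
predicate; the mixing prover is indifferent to the metric up to constants). Leans on: tree
`qcdPhaseQuenchedExpect_eq_div_prod`, `qcdPhaseQuenchedExpect_eq_integral_qcdLatticeMeasure`,
`isProbabilityMeasure_qcdLatticeMeasure`, `QCDRegularisation.tendsto_a`; Mathlib `ZMod.val` arithmetic,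
`Filter.Tendsto.eventually_le_const`-type lemmas. -/
theorem stub_pinOfFloor : Statement.stub_pinOfFloor := by
  sorry

/-- **Stub 4 — the tuned witness: ONE regularisation carrying dilution, floor and mixing (OPEN; the line's
hardest stub; its floor conjunct is Yang–Mills-hard).** For `N_f ∈ {2,3}` there is ONE mass-independent `reg`
(HasMassScaling, HasAsymptoticScaling) with `M₀, b₀, ℓ` such that every mass tuple `m > M₀` has a physical size
`R`, block data `L_b, d₀ > 0`, a floor `p₀ > 0` and a mixing constant `θ ≤ 1/8` with
(i) `DilutionClause reg b₀ ℓ m R` — clause (a) VERBATIM: NOT this line's content but the partner (a)-line's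
deliverable (route crux `EarlyCrosserLaw` (a′) via `SignDefectForcesCrossing`, or the transfers of cards
`mass-wegner-cell-index` / `count-the-flow` / `mirror-doubling`); it rides in this stub only because the witness
`reg` is SHARED — (a) pins `m_crit(k)` to the chiral line from below (valence masses in the sign-rigid regime),
the floor pins it from above (probe in the parity-fluctuating regime), and neither half implies the other (the
heavy junk `mcrit ≡ 1` has (a) without the floor, `mcrit ≡ −1` the floor without (a)); the lead should graft the
picked (a)-line's `C⁺_a` here under the same `reg`;
(ii) `BlockFloor reg M₀ m Lb p₀ R` — THIS LINE'S LOAD-BEARING INPUT: conditional sign non-degeneracy of one block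
of physical side `L_b` (`L_b Λ ≪ 1` allowed: weak coupling is honest there), `E m_b = 2E[r_b(1−r_b)] ≥ p₀`
k-uniformly — physically `p₀ ≍ (L_bΛ)^b (m L_b)^{N_f} × O(1)`, `b = 11 − 2N_f/3`, the ASYMPTOTIC-SCALING density of
blocks whose re-drawing changes the parity of the crossed real modes above the probe (small topological lumps of
size `< L_b`; all lumps of fixed physical size have crossed above the probe eventually in `k`, since a lump of
lattice size `ρ` crosses at `m_c − c_I/ρ²` and `c_I Z_m a_k/M → 0`), a LOWER bound at the UV-convergent end of
the size integral (restrict integrals, drop positive terms) — but a rigorous semiclassical lower bound under the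
phase-quenched SU(3) measure in a block with `(L_b/a_k)⁴ → ∞` sites, integrating the Gaussian fluctuations
honestly (NOT from Haar small balls: `UnitaryHaarSmallBall` is the warning), i.e. a Bałaban /
Magnen–Rivasseau–Sénéor finite-physical-volume statement plus `|det|`-tilt control on the block — open;
`p₀` must not depend on `M` (it does not in the physics: for every fixed `M` the `k → ∞` flip propensity is the
same parity-change probability; the `k`-threshold may depend on `M`, which the clause allows);
(iii) `RatioMixing reg M₀ m Lb d₀ θ R` — relative clustering of the two rare block events at physical separation
`d₀` (dipole–dipole interaction of lumps `∝ (ρ/d₀)⁴ · 8π²/g²`, quantum interactions equally suppressed; `θ ≤ 1/8`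
needs `d₀` of a few tenths of a fermi) — the clustering input the route's bridge also takes (RobustYangMills +
heavy-valence decoupling); open, L–XL. Why it might fail: (ii) fails if the block parity-flip propensity is NOT
k-uniform — e.g. if crossings above the probe in a physical block are dominated by lattice-scale dislocations whose
density dies like a positive power of `a_k` with nothing physical underneath (then `p₀(k) → 0`; falsifier F-B1 of
the card: `p_odd(L_b)` vs `a` on CLS/quenched ensembles), or if the `|det|` tilt suppresses odd sectors of a block
beyond `(m L_b)^{N_f}`; (iii) fails if the flip propensity does not LOCALISE (near-zero modes of `γ₅ D_W` at the
probe delocalised — excluded outside the Aoki phase by Golterman–Shamir, but unproved), making `m_b` a global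
observable with `O(1)` relative covariances. Sources: tHooft1976, Weinberg2012 §10.12 (one-loop instanton density,
UV-convergent small-ρ end), Luscher1982Topology, MagnenRivasseauSeneor1993, Balaban1988Convergent /
Balaban1989LargeFieldII, GoltermanShamir2003, SchaeferSommerVirotta2010 (arXiv:1009.5228), Luscher2010WilsonFlow
§4–5, EdwardsHellerNarayanan1998, MohlerSchaefer2020, LevinPeres2017. -/
theorem stub_tunedWitness : Statement.stub_tunedWitness := by
  sorry

/-! ### §2 Glue and consistency with the landed negative lemmas (no `sorry` below this line) -/

section Glue

variable {Nf : ℕ}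

/-- `DilutionClause` is monotone in the torus threshold `R` (fewer tori to serve). -/
theorem dilutionClause_mono (reg : QCDRegularisation Nf) (b₀ : ℕ) (ℓ : ℝ) (m : Fin Nf → ℝ) {R R' : ℝ}
    (hRR' : R ≤ R') (h : DilutionClause reg b₀ ℓ m R) : DilutionClause reg b₀ ℓ m R' := by
  intro ε hε
  filter_upwards [h ε hε] with k hk
  intro S hS
  exact hk S (hRR'.trans hS)

/-- `PinClause` is monotone in the torus threshold `R`. -/
theorem pinClause_mono (reg : QCDRegularisation Nf) (m : Fin Nf → ℝ) (M₀ : ℝ) {R R' : ℝ}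
    (hRR' : R ≤ R') (h : PinClause reg m M₀ R) : PinClause reg m M₀ R' := by
  intro M hM
  filter_upwards [h M hM] with k hk
  intro S hS
  exact hk S (hRR'.trans hS)

/-- Outside the window `[−8, 0]` the sign is `+1` for EVERY gauge field (two-sided Seiler positivity, landed
`CoerciveSeaNegative.fermionDet_wilsonDirac_re_pos_of_pos_or_lt`; the `μ > 0` side is the tree's
`fermionDet_wilsonDirac_re_pos`, used by the landed `NegativeCellsDilutePinWindow.not_pin_at`). -/
theorem detSign_eq_one_of_window {N : ℕ} [NeZero N] {μp : ℝ} (hμ : 0 < μp ∨ μp < -8) (U : Cfg N) :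
    detSign μp U = 1 := by
  unfold detSign
  rw [if_neg]
  exact not_lt.mpr (Theorems.CoerciveSeaNegative.fermionDet_wilsonDirac_re_pos_of_pos_or_lt
    (fundamentalRep (Fin 3)) (fun g => fundamentalRep_mem_unitaryGroup g) U hμ).le

/-- Hence outside the window NO resampling ever flips the sign: the flip propensity vanishes identically. -/
theorem flipRate_eq_zero_of_window {N : ℕ} [NeZero N] (β : ℝ) (mq : Fin Nf → ℝ) {μp : ℝ}
    (hμ : 0 < μp ∨ μp < -8) (B : Set (Edge 4 N)) (U : Cfg N) : flipRate β mq μp B U = 0 := by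
  unfold flipRate
  have h0 : ∀ V : Cfg N, (if detSign μp (refit B U V) ≠ detSign μp U then (1 : ℝ) else 0) *
      pqWeight β mq (refit B U V) = 0 := by
    intro V
    rw [detSign_eq_one_of_window hμ, detSign_eq_one_of_window hμ, if_neg (fun h => h rfl), zero_mul]
  simp only [h0, integral_zero, zero_div]

/-- The phase-quenched expectation of the zero observable is `0` (whatever the denominator). -/
theorem qcdPhaseQuenchedExpect_zero_fun {S : ℕ} [NeZero S] (β : ℝ) (mq : Fin Nf → ℝ) :
    qcdPhaseQuenchedExpect β S mq (fun _ : Cfg S => (0 : ℝ)) = 0 := by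
  simp [qcdPhaseQuenchedExpect]

/-- **The floor honours the pin window** (consistency with the landed negative lemmas
`NegativeCellsDilutePinWindow.pin_window` / `CoerciveSeaNegative.fermionDet_wilsonDirac_re_pos_of_pos_or_lt`):
a block floor with `p₀ > 0` forces the probe mass into `[−8, 0]` for every `M > M₀`, eventually in `k` — outside
the window the flip propensity is identically `0` and its expectation is `0 < p₀`. So `stub_tunedWitness` kills
the same junk witnesses (`mcrit ≡ c > 0`, `mcrit → +∞`, `mcrit ≡ c < −8`) the disprover's `pin_window` kills. -/
theorem blockFloor_window {reg : QCDRegularisation Nf} {M₀ : ℝ} {m : Fin Nf → ℝ} {Lb p₀ Rf : ℝ}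
    (h : BlockFloor reg M₀ m Lb p₀ Rf) (hp₀ : 0 < p₀) {M : ℝ} (hM : M₀ < M) :
    ∀ᶠ k : ℕ in atTop, -8 ≤ probe reg M k ∧ probe reg M k ≤ 0 := by
  filter_upwards [h M hM] with k hk
  obtain ⟨S, hS⟩ := Theorems.NegativeCellsDilutePinWindow.exists_admissible_S reg Rf k
  have hx := hk S hS 0
  by_contra hcon
  have hμ : 0 < probe reg M k ∨ probe reg M k < -8 := by
    rcases not_and_or.mp hcon with h1 | h1
    · exact Or.inr (lt_of_not_ge h1)
    · exact Or.inl (lt_of_not_ge h1)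
  have hzero : flipRate (N := 2 * S + 1) (reg.β k) (bare reg m k) (probe reg M k)
      (linkBlock (0 : TorusSite 4 (2 * S + 1)) ⌈Lb / reg.a k⌉₊) = fun _ => (0 : ℝ) :=
    funext fun U => flipRate_eq_zero_of_window (reg.β k) (bare reg m k) hμ _ U
  rw [hzero, qcdPhaseQuenchedExpect_zero_fun] at hx
  exact absurd hx (not_le.mpr hp₀)

end Glue

/-- **`NegativeCellsDilute` from the four stubs** (kernel-checked, no `sorry` of its own; the hypotheses are, BY NAME,
the statements `Statement.stub_signMobility`, `Statement.stub_concentration`, `Statement.stub_pinOfFloor`,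
`Statement.stub_tunedWitness` of the four registered stubs).
Read the crux through `negativeCellsDilute_iff`; the witness data come from S₄; S₃ (fed S₁ and S₂) converts floor
and mixing into the pin on all tori of side `≥ R₀`; answer with `max R R₀` (dilution is monotone in `R`). -/
theorem NegativeCellsDilute_of :
    Statement.stub_signMobility → Statement.stub_concentration → Statement.stub_pinOfFloor →
      Statement.stub_tunedWitness →
        Summit.QuantumFields.QCD.Theses.NestedDissectionSea.NegativeCellsDilute := by
  intro h₁ h₂ h₃ h₄
  refine negativeCellsDilute_iff.mpr ?_
  intro Nf hNf
  obtain ⟨reg, hms, has, M₀, hM₀, b₀, hb₀, ℓ, hℓ, hm⟩ := h₄ Nf hNf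
  refine ⟨reg, hms, has, M₀, hM₀, b₀, hb₀, ℓ, hℓ, fun m hmM => ?_⟩
  obtain ⟨R, hR, Lb, d₀, p₀, θ, hLb, hd₀, hp₀, hθ, hθ8, hdil, hfloor, hmix⟩ := hm m hmM
  obtain ⟨R₀, hR₀, hpin⟩ := h₃ h₁ h₂ Nf reg M₀ m Lb d₀ p₀ θ R hLb hd₀ hp₀ hθ hθ8 hfloor hmix
  exact ⟨max R R₀, lt_max_of_lt_left hR, dilutionClause_mono reg b₀ ℓ m (le_max_left R R₀) hdil,
    hpin (max R R₀) (le_max_right R R₀)⟩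

/-- The crux modulo the four registered stubs (depends on their `sorry`s and on nothing else). -/
theorem NegativeCellsDilute_skeleton : Summit.QuantumFields.QCD.Theses.NestedDissectionSea.NegativeCellsDilute :=
  NegativeCellsDilute_of stub_signMobility stub_concentration stub_pinOfFloor stub_tunedWitness

end Summit.QuantumFields.QCD.Cruxes.NegativeCellsDilute.SignMobilityIdentity

end
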